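import Mathlib

/-!
# Crux `RankDefectRepresentations` (stmt-PneNP-18923), line `rank-dehn-ladder`: STAIRCASES IN THE TWO-FAMILY VISIBILITY PATTERN HAVE
# LENGTH AT MOST FOUR (lead g15 helper H3; memo `Cruxes/RankDefectRepresentations/Lines/rank-dehn-ladder-g15.md` §1, briefs `…-briefs-g15.md` §H3)

In the two-family visibility pattern a row of type `(p, q)` is VISIBLE from a column of type `(a, b)` when both coordinates differ (`p ≠ a` and
`q ≠ b`); otherwise the row lies in the CROSS `{p = a} ∪ {q = b}` of the column.  A STAIRCASE of length `ℓ` is a sequence of row types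
`(p i, q i)` and column types `(a j, b j)`, `i j < ℓ`, with row `i` visible from column `j` exactly when `j ≤ i`.  Staircases carry the
"triangular minimal rank" lower bound of the line (identity blocks of size `c₀` on the diagonal, zeros below: all rectangles have rank `≤ c₀`,
every completion has rank `ℓ c₀`), so their maximal length caps every refutation of that type.
* `ne_type_of_lt` — two rows `i < i'` of a staircase have different types (column `i'` sees row `i'` but not row `i`).
* `no_staircase_five` — there is NO staircase of length `5`: compare the crosses of the last two columns, which both contain rows `0,1,2`;
  if they coincide, row `3` separates them; if they share exactly one line, rows `0,1,2` lie on it and column `2` forces rows `0,1` onto one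
  point; if they share no line, rows `0,1,2` lie in the two intersection points — in every case two rows coincide, contradicting `ne_type_of_lt`.
* `staircase_four` — a staircase of length `4` exists (rows `(0,0),(0,2),(2,2),(2,3)`, columns `(1,1),(1,0),(0,0),(0,2)`), so the bound is sharp.
HONEST FRAMING: elementary combinatorics; a helper for the lead's budget lane (caps tmr-type refutations of core-linearity at `4 c₀`); the crux stays
open; P ≠ NP is not moved; F-N2 is a FRONTIER formal rung.
-/

set_option linter.dupNamespace false -- `Summit.PneNP.PneNP.…`: summit = sub-problem name (D-0017)

namespace Summit.PneNP.PneNP.Theorems.CnfIdealGenLengthRankDefectRepresentationsStaircaseBound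

/-- Two rows `i < i'` of a staircase cannot have the same type: column `i'` sees row `i'` (both coordinates differ) but not row `i`. -/
theorem ne_type_of_lt {m : ℕ} (p q a b : Fin m → ℕ)
    (hvis : ∀ i j : Fin m, j ≤ i → p i ≠ a j ∧ q i ≠ b j)
    (hinv : ∀ i j : Fin m, i < j → p i = a j ∨ q i = b j)
    (i i' : Fin m) (h : i < i') (hp : p i = p i') (hq : q i = q i') : False := by
  obtain ⟨h1, h2⟩ := hvis i' i' le_rfl
  rcases hinv i i' h with h3 | h3
  · exact h1 (hp.symm.trans h3)
  · exact h2 (hq.symm.trans h3)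

/-- **No staircase of length 5** in the two-family visibility pattern: there are no row types `(p i, q i)` and column types `(a j, b j)`,
`i j : Fin 5`, with `(p i, q i)` visible from `(a j, b j)` (both coordinates differ) exactly when `j ≤ i`.  Proof: the crosses of columns `3`
and `4` both contain rows `0,1,2`; split on `a 3 = a 4` / `b 3 = b 4`. -/
theorem no_staircase_five (p q a b : Fin 5 → ℕ)
    (hvis : ∀ i j : Fin 5, j ≤ i → p i ≠ a j ∧ q i ≠ b j)
    (hinv : ∀ i j : Fin 5, i < j → p i = a j ∨ q i = b j) : False := by
  have key := ne_type_of_lt p q a b hvis hinv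
  obtain ⟨v33p, v33q⟩ := hvis 3 3 le_rfl
  obtain ⟨v22p, v22q⟩ := hvis 2 2 le_rfl
  by_cases ha : a 3 = a 4 <;> by_cases hb : b 3 = b 4
  · -- the crosses of columns `3` and `4` coincide, but row `3` lies in the second and not in the first
    rcases hinv 3 4 (by decide) with h | h
    · exact v33p (h.trans ha.symm)
    · exact v33q (h.trans hb.symm)
  · -- `a 3 = a 4`, `b 3 ≠ b 4`: rows `0,1,2` lie on the vertical line `p = a 4`
    have hp : ∀ i : Fin 5, i < 3 → p i = a 4 := by
      intro i hi
      rcases hinv i 4 (lt_trans hi (by decide)) with h4 | h4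
      · exact h4
      rcases hinv i 3 hi with h3 | h3
      · exact h3.trans ha
      · exact absurd (h3.symm.trans h4) hb
    -- column `2` sees row `2`, so `a 2 ≠ a 4`, and rows `0,1` lie on the horizontal line `q = b 2`
    have hq : ∀ i : Fin 5, i < 2 → q i = b 2 := by
      intro i hi
      rcases hinv i 2 hi with h2 | h2
      · exact absurd ((hp 2 (by decide)).trans ((hp i (lt_trans hi (by decide))).symm.trans h2)) v22p
      · exact h2
    exact key 0 1 (by decide) ((hp 0 (by decide)).trans (hp 1 (by decide)).symm)
      ((hq 0 (by decide)).trans (hq 1 (by decide)).symm)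
  · -- `a 3 ≠ a 4`, `b 3 = b 4`: rows `0,1,2` lie on the horizontal line `q = b 4`
    have hq : ∀ i : Fin 5, i < 3 → q i = b 4 := by
      intro i hi
      rcases hinv i 4 (lt_trans hi (by decide)) with h4 | h4
      · rcases hinv i 3 hi with h3 | h3
        · exact absurd (h3.symm.trans h4) ha
        · exact h3.trans hb
      · exact h4
    -- column `2` sees row `2`, so `b 2 ≠ b 4`, and rows `0,1` lie on the vertical line `p = a 2`
    have hp : ∀ i : Fin 5, i < 2 → p i = a 2 := by
      intro i hi
      rcases hinv i 2 hi with h2 | h2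
      · exact h2
      · exact absurd ((hq 2 (by decide)).trans ((hq i (lt_trans hi (by decide))).symm.trans h2)) v22q
    exact key 0 1 (by decide) ((hp 0 (by decide)).trans (hp 1 (by decide)).symm)
      ((hq 0 (by decide)).trans (hq 1 (by decide)).symm)
  · -- both differ: rows `0,1,2` lie in the two points `(a 3, b 4)`, `(a 4, b 3)`, so two of them coincide
    have t : ∀ i : Fin 5, i < 3 → (p i = a 3 ∧ q i = b 4) ∨ (p i = a 4 ∧ q i = b 3) := by
      intro i hi
      rcases hinv i 3 hi with h3 | h3 <;> rcases hinv i 4 (lt_trans hi (by decide)) with h4 | h4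
      · exact absurd (h3.symm.trans h4) ha
      · exact Or.inl ⟨h3, h4⟩
      · exact Or.inr ⟨h4, h3⟩
      · exact absurd (h3.symm.trans h4) hb
    rcases t 0 (by decide) with ⟨p0, q0⟩ | ⟨p0, q0⟩ <;> rcases t 1 (by decide) with ⟨p1, q1⟩ | ⟨p1, q1⟩
    · exact key 0 1 (by decide) (p0.trans p1.symm) (q0.trans q1.symm)
    · rcases t 2 (by decide) with ⟨p2, q2⟩ | ⟨p2, q2⟩
      · exact key 0 2 (by decide) (p0.trans p2.symm) (q0.trans q2.symm)
      · exact key 1 2 (by decide) (p1.trans p2.symm) (q1.trans q2.symm)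
    · rcases t 2 (by decide) with ⟨p2, q2⟩ | ⟨p2, q2⟩
      · exact key 1 2 (by decide) (p1.trans p2.symm) (q1.trans q2.symm)
      · exact key 0 2 (by decide) (p0.trans p2.symm) (q0.trans q2.symm)
    · exact key 0 1 (by decide) (p0.trans p1.symm) (q0.trans q1.symm)

/-- **A staircase of length 4 exists** (so `no_staircase_five` is sharp): rows `(0,0),(0,2),(2,2),(2,3)`, columns `(1,1),(1,0),(0,0),(0,2)`. -/
theorem staircase_four : ∃ p q a b : Fin 4 → ℕ,
    (∀ i j : Fin 4, j ≤ i → p i ≠ a j ∧ q i ≠ b j) ∧ (∀ i j : Fin 4, i < j → p i = a j ∨ q i = b j) :=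
  ⟨![0, 0, 2, 2], ![0, 2, 2, 3], ![1, 1, 0, 0], ![1, 0, 0, 2], by decide, by decide⟩

end Summit.PneNP.PneNP.Theorems.CnfIdealGenLengthRankDefectRepresentationsStaircaseBound
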